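import Summits.AtomisticToContinuum.Crystallization.Theorems.FreeSplittingCertificatesRadiusLadder
import Summits.AtomisticToContinuum.Crystallization.Theorems.FreeSplittingCertificatesRadiusLadderStar959Data

/-!
# `FiniteRangeSplitting` (stmt-AtomisticToContinuum-12559): refuted rungs of the radius ladder, `δ ≤ 23/25`

Companion of `FreeSplittingCertificatesRadiusLadder` (the rung `RungAt δ R` = "`S_R(δ)`: a pair-splitting rule read
at radius `R` is feasible at hard core `δ`") and of the data file `…RadiusLadderStar959Data` (block-2b unit
`b2b-freesplit-A`, gens 3–4).  VALUE = theorems / kernel-checked certificates about what the lj-lp star certificates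
decide — NOT summit progress.

* PAIR RADII: for `R < δ` every bond pattern of a `δ`-separated configuration is `{0, v}` (or `∅`), which is
  midpoint-symmetric (`bondPattern_of_lt_sep`); so by star forcing (`eInf_le_half_sum_of_symmetric`) ONE
  `δ`-separated configuration with ONE site of half pair-sum `< B = -98309653/125000000 ≤ e_∞` (the tree's
  unconditional two-cone bound) refutes `RungAt δ R` for every `R < δ` (`not_rungAt_of_deepSite`).
* INSTANCE `Star21` (warm-up, human-checkable: centre + 20 integer points on the sphere of radius `1.0430`, pairwise
  distances `≥ 0.83443`, centre half pair-sum `10·V(1.0430…) = -0.7918… < B`): `not_rungAt_five_sixths`.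
* INSTANCE `Star959` (the lane's certified star `R_23o25`: `959` points of `10⁻⁷ℕ³`, a radially relaxed fcc ball;
  separation `≥ 0.9200018 ≥ 23/25` and per-shell energy rows certified in `…Star959Data` by `decide +kernel`):
  **`not_rungAt_23_25 : ∀ δ ≤ 23/25, ∀ R < 23/25, ¬ RungAt δ R`** — at every hard core `δ ≤ 23/25 = 0.947·a`
  (`a = 0.9712` the hcp spacing) every witness `(R, Φ)` of crux r2 `FiniteRangeSplitting` has `R ≥ 23/25`
  (`radius_ge_23_25_of_feasible`); centre half pair-sum `≤ -0.78927927 < B = -0.786477224`, margin `2.8e-3`.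
  Beyond `R ≈ 0.925` no unconditional star exists with the bound `B` (lane `UNCONDITIONAL.md`: the relaxed-fcc star
  family crosses `B` at `R = 0.9252`); the lane's stars up to `R = 0.981` are certified only against `e_hcp`, i.e.
  conditionally on `e_∞ = e_hcp` — improving the TREE's lower bound on `e_∞` is what moves this ladder further.
-/

noncomputable section

namespace Summit.AtomisticToContinuum.Crystallization.Theorems.StrictSplittingRuleBirth

open scoped BigOperators Classical
open Literature.MathematicalPhysics.StatisticalMechanics

/-- Euclidean `3`-space. -/
local notation "E3" => EuclideanSpace ℝ (Fin 3)


/-! ## Pair radii: `R < δ` -/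

/-- For `R < δ` the joint pattern of a bond of a `δ`-separated configuration is `{0, v}` (`R ≥ 0`) or `∅`
(`R < 0`); either way it is symmetric about the bond midpoint. -/
theorem bondPattern_of_lt_sep {δ R : ℝ} (hR : R < δ) {N : ℕ} {x : Fin N → E3} (hx : Sep δ x)
    {i j : Fin N} (hij : j ≠ i) :
    (bondPattern R x i j).image (fun u => (x j - x i) - u) = bondPattern R x i j := by
  unfold bondPattern
  by_cases hR0 : 0 ≤ R
  · have hf : (Finset.univ.filter fun l => dist (x l) (x i) ≤ R ∨ dist (x l) (x j) ≤ R) = {i, j} := by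
      ext l
      simp only [Finset.mem_filter, Finset.mem_univ, true_and, Finset.mem_insert,
        Finset.mem_singleton]
      constructor
      · rintro (h | h)
        · by_contra hne
          have h1 : l ≠ i := fun h' => hne (Or.inl h')
          have := hx l i h1
          linarith
        · by_contra hne
          have h1 : l ≠ j := fun h' => hne (Or.inr h')
          have := hx l j h1
          linarith
      · rintro (rfl | rfl)
        · left
          simp [hR0]
        · right
          simp [hR0]
    rw [hf, Finset.image_image]
    ext u
    simp only [Finset.mem_image, Finset.mem_insert, Finset.mem_singleton, Function.comp_apply]
    constructor
    · rintro ⟨l, hl, rfl⟩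
      rcases hl with rfl | rfl
      · exact ⟨j, Or.inr rfl, by abel⟩
      · exact ⟨i, Or.inl rfl, by abel⟩
    · rintro ⟨l, hl, rfl⟩
      rcases hl with rfl | rfl
      · exact ⟨j, Or.inr rfl, by abel⟩
      · exact ⟨i, Or.inl rfl, by abel⟩
  · replace hR0 : R < 0 := not_le.mp hR0
    have hf : (Finset.univ.filter fun l => dist (x l) (x i) ≤ R ∨ dist (x l) (x j) ≤ R) = ∅ :=
      Finset.filter_eq_empty_iff.mpr fun l _ =>
        not_or.mpr ⟨not_le.mpr (hR0.trans_le dist_nonneg), not_le.mpr (hR0.trans_le dist_nonneg)⟩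
    rw [hf]
    simp

/-- **A site below the two-cone bound refutes every pair-radius rung**: one `δ`-separated configuration with
one site of half pair-sum `< B ≤ e_∞` gives `¬ RungAt δ R` for every `R < δ` (unconditional). -/
theorem not_rungAt_of_deepSite {δ R : ℝ} (hδ : 0 < δ) (hR : R < δ) {N : ℕ} (x : Fin N → E3)
    (hx : Sep δ x) (i : Fin N)
    (hdeep : (∑ j ∈ Finset.univ.erase i, lennardJones (dist (x i) (x j))) / 2 < twoConeB) :
    ¬ RungAt δ R := fun hrung =>
  absurd (twoConeB_le_eInf.trans (eInf_le_half_sum_of_symmetric hδ hrung x hx i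
    fun _ hj => bondPattern_of_lt_sep hR hx hj)) (not_le.mpr hdeep)

/-- `V_LJ(√q) = q⁻⁶/12 − q⁻³/6`: the potential as a rational function of the squared distance. -/
theorem lennardJones_sqrt {q : ℝ} (hq : 0 ≤ q) :
    lennardJones (Real.sqrt q) = 1 / 12 * (q ^ 6)⁻¹ - 1 / 6 * (q ^ 3)⁻¹ := by
  unfold lennardJones
  have h2 : Real.sqrt q ^ 2 = q := Real.sq_sqrt hq
  rw [inv_pow, inv_pow, show Real.sqrt q ^ 12 = (Real.sqrt q ^ 2) ^ 6 by ring,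
    show Real.sqrt q ^ 6 = (Real.sqrt q ^ 2) ^ 3 by ring, h2]

/-! ## Instance `Star21`: `¬ RungAt δ R` for all `δ ≤ 5/6`, `R < 5/6` -/

namespace Star21

/-- Coordinate table in units of `10⁻⁴`: the centre and 20 integer points on the sphere `|P|² = 108785141`
(radius `1.04300`), a near-Tammes 20-point code (min angle `47.37°`); pairwise squared distances
`≥ 69627210 > (5/6)²·10⁸`. [folklore] -/
def P : Fin 21 → Fin 3 → ℤ :=
  ![![0, 0, 0], ![-9584, 994, 3993], ![9420, 746, -4415], ![2274, 9484, -3697], ![8044, 6447, 1586],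
    ![4798, 3271, 8664], ![4346, -4920, -8105], ![-6532, 8106, 641], ![3154, 3348, -9361], ![-8066,
    -6577, 684], ![3584, -5001, 8422], ![-4764, -4529, 8098], ![-2391, -8822, -5024], ![-3358, -1956,
    -9679], ![-4478, 6031, -7236], ![786, 9361, 4532], ![6532, -8106, -641], ![-3552, 3719, 9074],
    ![-9496, -23, -4314], ![-708, -9919, 3146], ![9614, -1512, 3751]]

/-- All 20 outer points lie on the integer sphere `|P|² = 108785141`. [folklore] -/
theorem P_sphere : ∀ j : Fin 21, j ≠ 0 →
    (P 0 0 - P j 0) ^ 2 + (P 0 1 - P j 1) ^ 2 + (P 0 2 - P j 2) ^ 2 = 108785141 := by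
  decide

/-- Pairwise squared integer distances are `≥ 69627210 > (5/6)²·10⁸`. [folklore] -/
theorem P_sep : ∀ i j : Fin 21, i ≠ j →
    (69627210 : ℤ) ≤ (P i 0 - P j 0) ^ 2 + (P i 1 - P j 1) ^ 2 + (P i 2 - P j 2) ^ 2 := by
  decide

/-- The configuration `x_k = 10⁻⁴ · P_k`. [folklore] -/
def conf : Fin 21 → E3 := fun k => WithLp.toLp 2 fun c => (P k c : ℝ) / 10000

/-- Coordinates of the configuration (`rfl`). [folklore] -/
theorem conf_apply (k : Fin 21) (c : Fin 3) : conf k c = (P k c : ℝ) / 10000 := rfl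

/-- Squared distances of the configuration from the integer table. [folklore] -/
theorem dist_conf_sq (i j : Fin 21) :
    dist (conf i) (conf j) ^ 2 =
      (((P i 0 - P j 0) ^ 2 + (P i 1 - P j 1) ^ 2 + (P i 2 - P j 2) ^ 2 : ℤ) : ℝ) / 10000 ^ 2 := by
  rw [EuclideanSpace.dist_eq, Real.sq_sqrt (Finset.sum_nonneg fun _ _ => sq_nonneg _),
    Fin.sum_univ_three]
  simp only [conf_apply, Real.dist_eq, sq_abs]
  push_cast
  ring

/-- Every outer point is at distance `√(108785141)/10⁴ = 1.04300…` from the centre. [folklore] -/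
theorem dist_centre (j : Fin 21) (hj : j ≠ 0) :
    dist (conf 0) (conf j) = Real.sqrt (108785141 / 10000 ^ 2) := by
  have h2 : dist (conf 0) (conf j) ^ 2 = 108785141 / 10000 ^ 2 := by
    rw [dist_conf_sq, P_sphere j hj]
    norm_num
  rw [← h2, Real.sqrt_sq dist_nonneg]

/-- The configuration is `5/6`-separated. [folklore] -/
theorem sep_conf : Sep (5 / 6) conf := by
  intro i j hij
  have hD : ((69627210 : ℤ) : ℝ) ≤
      (((P i 0 - P j 0) ^ 2 + (P i 1 - P j 1) ^ 2 + (P i 2 - P j 2) ^ 2 : ℤ) : ℝ) := by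
    exact_mod_cast P_sep i j hij
  have h2 : (25 / 36 : ℝ) ≤ dist (conf i) (conf j) ^ 2 := by
    rw [dist_conf_sq, le_div_iff₀ (by norm_num)]
    push_cast at hD ⊢
    linarith
  nlinarith [dist_nonneg (x := conf i) (y := conf j), h2]

/-- The centre half pair-sum `10·V(1.04300…) = -0.7918…` is below the two-cone bound `B`. [folklore] -/
theorem centre_half_sum :
    (∑ j ∈ Finset.univ.erase (0 : Fin 21), lennardJones (dist (conf 0) (conf j))) / 2 < twoConeB := by
  have h : ∀ j ∈ Finset.univ.erase (0 : Fin 21),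
      lennardJones (dist (conf 0) (conf j)) = lennardJones (Real.sqrt (108785141 / 10000 ^ 2)) := by
    intro j hj
    rw [dist_centre j (Finset.ne_of_mem_erase hj)]
  rw [Finset.sum_congr rfl h, Finset.sum_const, Finset.card_erase_of_mem (Finset.mem_univ _),
    Finset.card_univ, Fintype.card_fin, lennardJones_sqrt (by positivity)]
  unfold twoConeB
  norm_num

end Star21

/-- **The first refuted rungs, as a theorem.**  For every hard core `δ ≤ 5/6` and every pattern radius
`R < 5/6` there is NO feasible pair-splitting rule: `¬ S_R(δ)`.  Unconditional (threshold = tree two-cone bound). -/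
theorem not_rungAt_five_sixths : ∀ δ R : ℝ, δ ≤ 5 / 6 → R < 5 / 6 → ¬ RungAt δ R := by
  intro δ R hδ hR hrung
  have h56 : ¬ RungAt (5 / 6) R :=
    not_rungAt_of_deepSite (by norm_num) hR Star21.conf Star21.sep_conf 0 Star21.centre_half_sum
  exact h56 (rungAt_mono_sep hδ hrung)

/-- Read back on crux r2: every witness `(R, Φ)` of `FiniteRangeSplitting` at a hard core `δ ≤ 5/6` has
pattern radius `R ≥ 5/6` (`= 0.858·a`, `a = 0.9712` the hcp spacing): rules must look beyond pair distance. -/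
theorem radius_ge_of_feasible {δ R : ℝ} (hδ : δ ≤ 5 / 6) {Φ : E3 → Finset E3 → ℝ} (hr : IsRule Φ)
    (hf : Feasible δ R Φ) : 5 / 6 ≤ R :=
  not_lt.mp fun hR => not_rungAt_five_sixths δ R hδ hR ⟨Φ, hr, hf⟩

/-! ## Scaled grid points in `ℝ³` -/

/-- `(nd m n)² = (m - n)²` over `ℝ`. [folklore] -/
theorem nd_mul_self_cast (m n : ℕ) : ((nd m n * nd m n : ℕ) : ℝ) = ((m : ℝ) - n) ^ 2 := by
  unfold nd
  rcases le_total m n with h | h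
  · rw [Nat.sub_eq_zero_of_le h, zero_add]
    push_cast [Nat.cast_sub h]
    ring
  · rw [Nat.sub_eq_zero_of_le h, add_zero]
    push_cast [Nat.cast_sub h]
    ring

/-- The squared grid distance over `ℝ`. [folklore] -/
theorem isq_cast (a b : ℕ × ℕ × ℕ) : ((isq a b : ℕ) : ℝ) =
    ((a.1 : ℝ) - b.1) ^ 2 + ((a.2.1 : ℝ) - b.2.1) ^ 2 + ((a.2.2 : ℝ) - b.2.2) ^ 2 := by
  unfold isq
  rw [Nat.cast_add, Nat.cast_add, nd_mul_self_cast, nd_mul_self_cast, nd_mul_self_cast]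

/-- The point of `ℝ³` with coordinates `a/10⁷`. [folklore] -/
def pt (a : ℕ × ℕ × ℕ) : E3 := !₂[(a.1 : ℝ) / 10 ^ 7, (a.2.1 : ℝ) / 10 ^ 7, (a.2.2 : ℝ) / 10 ^ 7]

/-- Distances of scaled grid points: `dist (a/10⁷) (b/10⁷) = √(isq a b / 10¹⁴)`. [folklore] -/
theorem dist_pt (a b : ℕ × ℕ × ℕ) : dist (pt a) (pt b) = Real.sqrt ((isq a b : ℝ) / 10 ^ 14) := by
  rw [EuclideanSpace.dist_eq, isq_cast]
  congr 1
  simp [pt, Fin.sum_univ_three, Real.dist_eq, sq_abs]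
  ring

/-- A grid-distance bound `(23/25)²·10¹⁴ ≤ isq a b` gives `23/25 ≤ dist`. [folklore] -/
theorem le_dist_pt {a b : ℕ × ℕ × ℕ} (h : 84640000000000 ≤ isq a b) : 23 / 25 ≤ dist (pt a) (pt b) := by
  rw [dist_pt]
  apply Real.le_sqrt_of_sq_le
  rw [le_div_iff₀ (by positivity)]
  have h' : ((84640000000000 : ℕ) : ℝ) ≤ (isq a b : ℝ) := by exact_mod_cast h
  push_cast at h'
  nlinarith [h']

/-- ROW SOUNDNESS: the integer inequality `10⁹³ + 12·b·n⁶ ≤ 2·10⁵¹·n³` is `V_LJ(√(n/10¹⁴)) ≤ -b/10⁹`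
cleared of denominators. [folklore] -/
theorem lennardJones_sqrt_le_of_row {n b : ℕ} (hn : 0 < n)
    (h : 10 ^ 93 + 12 * b * n ^ 6 ≤ 2 * 10 ^ 51 * n ^ 3) :
    lennardJones (Real.sqrt ((n : ℝ) / 10 ^ 14)) ≤ -((b : ℝ) / 10 ^ 9) := by
  have hn' : (0 : ℝ) < n := Nat.cast_pos.mpr hn
  have hn0 : (n : ℝ) ≠ 0 := hn'.ne'
  have hc : (10 : ℝ) ^ 93 + 12 * (b : ℝ) * (n : ℝ) ^ 6 ≤ 2 * 10 ^ 51 * (n : ℝ) ^ 3 := by exact_mod_cast h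
  rw [lennardJones_sqrt (by positivity)]
  have key : 1 / 12 * (((n : ℝ) / 10 ^ 14) ^ 6)⁻¹ - 1 / 6 * (((n : ℝ) / 10 ^ 14) ^ 3)⁻¹ + (b : ℝ) / 10 ^ 9 =
      ((10 : ℝ) ^ 93 + 12 * (b : ℝ) * (n : ℝ) ^ 6 - 2 * 10 ^ 51 * (n : ℝ) ^ 3) / (12 * 10 ^ 9 * (n : ℝ) ^ 6) := by
    field_simp
    ring
  have hle : ((10 : ℝ) ^ 93 + 12 * (b : ℝ) * (n : ℝ) ^ 6 - 2 * 10 ^ 51 * (n : ℝ) ^ 3) / (12 * 10 ^ 9 * (n : ℝ) ^ 6)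
      ≤ 0 :=
    div_nonpos_of_nonpos_of_nonneg (by linarith) (by positivity)
  linarith

/-! ## The configuration of the instance `Star959` -/

namespace Star959

/-- The configuration `x_k = pts[k] / 10⁷`. [folklore] -/
def conf (k : Fin pts.length) : E3 := pt pts[k.1]

/-- The centre index. [folklore] -/
def i0 : Fin pts.length := ⟨0, length_pos⟩

/-- The configuration is `23/25`-separated. [folklore] -/
theorem sep_conf : Sep (23 / 25) conf := by
  intro i j hij
  have hp := List.pairwise_iff_getElem.mp pairwise_sep
  rcases lt_or_gt_of_ne (Fin.val_injective.ne hij) with h | h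
  · exact le_dist_pt (hp i.1 j.1 i.2 j.2 h)
  · rw [dist_comm]
    exact le_dist_pt (hp j.1 i.1 j.2 i.2 h)

/-- Per-point energy bound at the centre. [folklore] -/
theorem term_le {a : ℕ × ℕ × ℕ} (ha : a ∈ pts) :
    lennardJones (dist (pt ctr) (pt a)) ≤ -((bOf (isq ctr a) : ℝ) / 10 ^ 9) := by
  rcases List.mem_cons.mp ha with rfl | ha'
  · rw [dist_self, bOf_zero]
    norm_num [lennardJones]
  · obtain ⟨hn, hrow⟩ := rows_ok a ha'
    rw [dist_pt]
    exact lennardJones_sqrt_le_of_row hn hrow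

/-- The centre half pair-sum is `≤ -0.78927927 < B`. [folklore] -/
theorem centre_half_sum :
    (∑ j ∈ Finset.univ.erase i0, lennardJones (dist (conf i0) (conf j))) / 2 < twoConeB := by
  have h0 : lennardJones (dist (conf i0) (conf i0)) = 0 := by
    rw [dist_self]
    norm_num [lennardJones]
  rw [Finset.sum_erase Finset.univ (f := fun j => lennardJones (dist (conf i0) (conf j))) h0]
  have hle : ∑ j : Fin pts.length, lennardJones (dist (conf i0) (conf j)) ≤
      ∑ j : Fin pts.length, -((bOf (isq ctr pts[j.1]) : ℝ) / 10 ^ 9) :=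
    Finset.sum_le_sum fun j _ => term_le (List.getElem_mem j.2)
  have hsum : ∑ j : Fin pts.length, -((bOf (isq ctr pts[j.1]) : ℝ) / 10 ^ 9) =
      -(((pts.map fun a => bOf (isq ctr a)).sum : ℕ) : ℝ) / 10 ^ 9 := by
    rw [← Fin.sum_univ_fun_getElem, Nat.cast_sum, Finset.sum_neg_distrib, ← Finset.sum_div, neg_div]
  rw [hsum, sum_b] at hle
  unfold twoConeB
  push_cast at hle
  linarith

end Star959

/-- **Refuted rungs up to `23/25`, as a theorem.**  For every hard core `δ ≤ 23/25` and every pattern radius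
`R < 23/25` there is NO feasible pair-splitting rule: `¬ S_R(δ)`.  Unconditional (threshold = tree two-cone bound). -/
theorem not_rungAt_23_25 : ∀ δ R : ℝ, δ ≤ 23 / 25 → R < 23 / 25 → ¬ RungAt δ R := by
  intro δ R hδ hR hrung
  have h : ¬ RungAt (23 / 25) R :=
    not_rungAt_of_deepSite (by norm_num) hR Star959.conf Star959.sep_conf Star959.i0 Star959.centre_half_sum
  exact h (rungAt_mono_sep hδ hrung)

/-- Read back on crux r2: every witness `(R, Φ)` of `FiniteRangeSplitting` at a hard core `δ ≤ 23/25` has pattern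
radius `R ≥ 23/25` (`= 0.947·a`): feasible rules must read beyond `0.947` nearest-neighbour distances. -/
theorem radius_ge_23_25_of_feasible {δ R : ℝ} (hδ : δ ≤ 23 / 25) {Φ : E3 → Finset E3 → ℝ} (hr : IsRule Φ)
    (hf : Feasible δ R Φ) : 23 / 25 ≤ R :=
  not_lt.mp fun hR => not_rungAt_23_25 δ R hδ hR ⟨Φ, hr, hf⟩

end Summit.AtomisticToContinuum.Crystallization.Theorems.StrictSplittingRuleBirth

end
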